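import Literature.Topology.PlanarFoliations.JordanSack
import Literature.Topology.PlanarFoliations.Reverse
import HarnessLib

/-!
# The Bendixson sack traps the other leaves

Topic: Topology / PlanarFoliations, sequel to `JordanSack.lean` (the sack of two successive
crossings `p₁ < p₂` of an open leaf `L = F.Leaf x` with the vertical `u = u₀` of a flow box `e`;
its right and left sides `rightSide`, `leftSide`, the complementary components containing the
points just right and just left of the vertical segment; `mem_rightSide_of_lt`: after `p₂` the
leaf `L` stays in the right side), `Transversals.lean` (crossings, `exists_first_crossing`),
`Reverse.lean` (α-limit sets). **A leaf `L' ≠ L` crossing the vertical segment strictly inside is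
trapped**: all its points after the crossing lie in the right side, all its points before it in
the left side (`SackData.mem_rightSide_of_fwd`, `SackData.mem_leftSide_of_bwd`) — the open leaf
interval from the crossing to the next crossing of the segment (if any) misses the sack boundary,
starts just right of the segment and would end just left of it, in two different components
(`rightSide_ne_leftSide`). Hence **its ω-limit set lies in the closure of the right side and its
α-limit set in the closure of the left side** (`omegaSet_subset_closure_rightSide`,
`alphaSet_subset_closure_leftSide`). This is the classical "an orbit entering the sack never
leaves it" (Camacho–Lins Neto, Ch. VII §2, p. 131).

## References

* C. Camacho, A. Lins Neto, *Geometric Theory of Foliations*, Birkhäuser (1985), Ch. VII §2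
  [CamachoLinsNeto1985].
-/

noncomputable section

open Set Filter Function
open _root_.Topology
open Literature.Topology.FourManifolds Literature.Topology.FourManifolds.Foliation

namespace Literature.Topology.PlanarFoliations

variable {X : Type*} [TopologicalSpace X] [T2Space X] [SecondCountableTopology X] {F : Foliation ℝ X}
variable {hbi : IsBiOriented F} {e : OpenPartialHomeomorph X (ℝ × ℝ)} {u₀ : ℝ} {ι : X → ℂ}

namespace SackData

variable {x : X} [NoncompactSpace (F.Leaf x)] (D : SackData hbi x e u₀) {y : X} [NoncompactSpace (F.Leaf y)]

/-! ## Points of another leaf on the sack boundary are crossings of the segment -/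

omit [T2Space X] [SecondCountableTopology X] [NoncompactSpace (F.Leaf x)] [NoncompactSpace (F.Leaf y)] in
/-- A point of `X` over a point of the vertical is a crossing at that height. [folklore] -/
theorem isCrossing_of_pt_eq_vert (he : e ∈ F.atlas) {s : F.Leaf y} {t : ℝ} (hst : vert e u₀ t = Leaf.pt s) :
    IsCrossing e u₀ s ∧ ht e s = t := by
  have hsrc : Leaf.pt s ∈ e.source := by
    rw [← hst]; exact e.map_target (by rw [F.target_eq e he]; exact mem_univ _)
  have hes : e (Leaf.pt s) = (u₀, t) := by
    rw [← hst, vert, e.right_inv (by rw [F.target_eq e he]; exact mem_univ _)]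
  exact ⟨⟨hsrc, by rw [hes]⟩, by show (e (Leaf.pt s)).2 = t; rw [hes]⟩

omit [NoncompactSpace (F.Leaf y)] in
/-- **A point of a leaf disjoint from `L` whose image is on the sack boundary is a crossing of the
segment**, at a height in `[tlo, thi]`. [folklore] -/
theorem isCrossing_of_mem_traceX (he : e ∈ F.atlas) (hιi : Injective ι) (hdisj : Disjoint (F.leaf y) (F.leaf x))
    {s : F.Leaf y} (hs : ι (Leaf.pt s) ∈ ι '' D.traceX) : IsCrossing e u₀ s ∧ ht e s ∈ Icc D.tlo D.thi := by
  obtain ⟨w, hw, hws⟩ := hs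
  have hw' : w = Leaf.pt s := hιi hws
  subst hw'
  rcases hw with ⟨σ, -, hσs⟩ | ⟨t, htI, hts⟩
  · exact absurd (show Leaf.pt s ∈ F.leaf x by rw [← hσs]; exact (D.g.symm σ).2) (disjoint_left.1 hdisj s.2)
  · obtain ⟨hcr, hst⟩ := isCrossing_of_pt_eq_vert he hts
    rw [D.uIcc_eq] at htI
    exact ⟨hcr, hst ▸ htI⟩

omit [NoncompactSpace (F.Leaf y)] in
/-- A crossing of a leaf disjoint from `L` at a height in `[tlo, thi]` has height in `(tlo, thi)`:
the end heights are those of `p₁`, `p₂ ∈ L`. [folklore] -/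
theorem ht_mem_Ioo_of_isCrossing (hdisj : Disjoint (F.leaf y) (F.leaf x)) {s : F.Leaf y}
    (hcr : IsCrossing e u₀ s) (hsT : ht e s ∈ Icc D.tlo D.thi) : ht e s ∈ Ioo D.tlo D.thi := by
  have hne : ∀ (p : F.Leaf x), IsCrossing e u₀ p → ht e s ≠ ht e p := by
    intro p hp h
    have heq : Leaf.pt s = Leaf.pt p := by rw [hcr.pt_eq, hp.pt_eq, h]
    have hp2 : Leaf.pt p ∈ F.leaf x := p.2
    rw [← heq] at hp2
    exact disjoint_left.1 hdisj s.2 hp2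
  have h₁ := hne _ D.cross₁
  have h₂ := hne _ D.cross₂
  refine ⟨lt_of_le_of_ne hsT.1 (fun h ↦ ?_), lt_of_le_of_ne hsT.2 (fun h ↦ ?_)⟩
  · rcases min_choice D.t₁ D.t₂ with h' | h'
    · exact h₁ (h.symm.trans h')
    · exact h₂ (h.symm.trans h')
  · rcases max_choice D.t₁ D.t₂ with h' | h'
    · exact h₁ (h.trans h')
    · exact h₂ (h.trans h')

/-! ## Local sides at a crossing of another leaf -/

/-- **Just after a crossing of the segment strictly inside, a leaf is in the right side.**
[folklore] -/
theorem eventually_mem_rightSide_after_of_isCrossing (he : e ∈ F.atlas) (hιc : Continuous ι) (hιi : Injective ι)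
    {c : F.Leaf y} (hc : IsCrossing e u₀ c) (hct : ht e c ∈ Ioo D.tlo D.thi) :
    ∀ᶠ q in 𝓝 c, leafLT hbi c q → ι (Leaf.pt q) ∈ D.rightSide he ι := by
  obtain ⟨δ, hδ, hright⟩ := D.eventually_mem_rightSide he hιc hιi hct
  have hev := eventually_leafLT_iff_lt_fst (hbi := hbi) he hc
  have hca : ContinuousAt (fun q : F.Leaf y ↦ (e (Leaf.pt q)).1) c :=
    continuous_fst.continuousAt.comp ((e.continuousAt hc.1).comp (Leaf.continuous_coe F y).continuousAt)
  have hlt : ∀ᶠ q in 𝓝 c, (e (Leaf.pt q)).1 < u₀ + δ := by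
    have h0 : (fun q : F.Leaf y ↦ (e (Leaf.pt q)).1) c < u₀ + δ := by
      show (e (Leaf.pt c)).1 < u₀ + δ
      rw [hc.2]; linarith
    exact hca.eventually (Iio_mem_nhds h0)
  filter_upwards [hev, hlt] with q hq hqlt hcq
  obtain ⟨hsrc, hht, hiff, -⟩ := hq
  have hu : u₀ < (e (Leaf.pt q)).1 := hiff.1 hcq
  rw [pt_eq_symm hsrc, hht]
  exact hright _ ⟨hu, hqlt⟩

/-- **Just before a crossing of the segment strictly inside, a leaf is in the left side.**
[folklore] -/
theorem eventually_mem_leftSide_before_of_isCrossing (he : e ∈ F.atlas) (hιc : Continuous ι) (hιi : Injective ι)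
    {c : F.Leaf y} (hc : IsCrossing e u₀ c) (hct : ht e c ∈ Ioo D.tlo D.thi) :
    ∀ᶠ q in 𝓝 c, leafLT hbi q c → ι (Leaf.pt q) ∈ D.leftSide he ι := by
  obtain ⟨δ, hδ, hleft⟩ := D.eventually_mem_leftSide he hιc hιi hct
  have hev := eventually_leafLT_iff_lt_fst (hbi := hbi) he hc
  have hca : ContinuousAt (fun q : F.Leaf y ↦ (e (Leaf.pt q)).1) c :=
    continuous_fst.continuousAt.comp ((e.continuousAt hc.1).comp (Leaf.continuous_coe F y).continuousAt)
  have hgt : ∀ᶠ q in 𝓝 c, u₀ - δ < (e (Leaf.pt q)).1 := by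
    have h0 : u₀ - δ < (fun q : F.Leaf y ↦ (e (Leaf.pt q)).1) c := by
      show u₀ - δ < (e (Leaf.pt c)).1
      rw [hc.2]; linarith
    exact hca.eventually (Ioi_mem_nhds h0)
  filter_upwards [hev, hgt] with q hq hqgt hqc
  obtain ⟨hsrc, hht, -, hiff⟩ := hq
  have hu : (e (Leaf.pt q)).1 < u₀ := hiff.1 hqc
  rw [pt_eq_symm hsrc, hht]
  exact hleft _ ⟨hqgt, hu⟩

/-! ## An open leaf interval off the boundary with points on both sides is impossible -/

/-- **An open leaf interval of a leaf disjoint from `L`, without crossings of the segment strictly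
inside, starting at a crossing strictly inside and ending at one, does not exist.** [folklore] -/
theorem false_of_crossings (he : e ∈ F.atlas) (hι : IsOpenEmbedding ι) (hdisj : Disjoint (F.leaf y) (F.leaf x))
    {c r : F.Leaf y} (hcr : leafLT hbi c r) (hc : IsCrossing e u₀ c) (hct : ht e c ∈ Ioo D.tlo D.thi)
    (hr : IsCrossing e u₀ r) (hrt : ht e r ∈ Ioo D.tlo D.thi)
    (hno : ∀ s, leafLT hbi c s → leafLT hbi s r → ¬ (IsCrossing e u₀ s ∧ ht e s ∈ Icc D.tlo D.thi)) : False := by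
  have hιc := hι.continuous
  have hιi := hι.injective
  set O := leafIoo hbi c r with hO
  set S := (fun s : F.Leaf y ↦ ι (Leaf.pt s)) '' O with hS
  have hSc : IsPreconnected S :=
    (isPreconnected_leafIoo c r).image _ (hιc.comp (Leaf.continuous_coe F y)).continuousOn
  have hSsub : S ⊆ (ι '' D.traceX)ᶜ := by
    rintro _ ⟨s, ⟨hs₁, hs₂⟩, rfl⟩ hs
    exact hno s hs₁ hs₂ (D.isCrossing_of_mem_traceX he hιi hdisj hs)
  -- a point of `S` just after `c`, in the right side
  obtain ⟨q₁, hq₁O, hq₁R⟩ : ∃ q₁ ∈ O, ι (Leaf.pt q₁) ∈ D.rightSide he ι := by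
    have hev := (isOpen_setOf_leafLT_left (hbi := hbi) r).mem_nhds hcr
    have h := (frequently_leafLT_right (hbi := hbi) c).and_eventually
      ((D.eventually_mem_rightSide_after_of_isCrossing he hιc hιi hc hct).and hev)
    obtain ⟨q₁, hlt, himp, hq'⟩ := h.exists
    exact ⟨q₁, ⟨hlt, hq'⟩, himp hlt⟩
  -- a point of `S` just before `r`, in the left side
  obtain ⟨q₂, hq₂O, hq₂L⟩ : ∃ q₂ ∈ O, ι (Leaf.pt q₂) ∈ D.leftSide he ι := by
    have hev := (isOpen_setOf_leafLT_right (hbi := hbi) c).mem_nhds hcr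
    have h := (frequently_leafLT_left (hbi := hbi) r).and_eventually
      ((D.eventually_mem_leftSide_before_of_isCrossing he hιc hιi hr hrt).and hev)
    obtain ⟨q₂, hlt, himp, hq'⟩ := h.exists
    exact ⟨q₂, ⟨hq', hlt⟩, himp hlt⟩
  have h₁ := hSc.subset_connectedComponentIn (mem_image_of_mem _ hq₁O) hSsub (mem_image_of_mem _ hq₂O)
  have h₂ := hSc.subset_connectedComponentIn (mem_image_of_mem _ hq₂O) hSsub (mem_image_of_mem _ hq₂O)
  refine D.rightSide_ne_leftSide he hι ?_
  rw [rightSide] at hq₁R ⊢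
  rw [leftSide] at hq₂L ⊢
  rw [connectedComponentIn_eq hq₁R, connectedComponentIn_eq hq₂L, ← connectedComponentIn_eq h₁]

/-! ## The trap -/

/-- **After a crossing of the segment strictly inside, a leaf disjoint from `L` never crosses the
segment again.** [folklore] -/
theorem not_isCrossing_after (he : e ∈ F.atlas) (hι : IsOpenEmbedding ι) (hdisj : Disjoint (F.leaf y) (F.leaf x))
    {c : F.Leaf y} (hc : IsCrossing e u₀ c) (hct : ht e c ∈ Ioo D.tlo D.thi) {s : F.Leaf y} (hcs : leafLT hbi c s)
    (hs : IsCrossing e u₀ s) : ht e s ∉ Icc D.tlo D.thi := by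
  intro hsT
  -- the first crossing after `c` with height in `[tlo, thi]`
  obtain ⟨r, hcr, -, hr, hrT, hfirst⟩ := exists_first_crossing (hbi := hbi) he isClosed_Icc (Metric.isBounded_Icc _ _) hcs hs hsT
  exact D.false_of_crossings he hι hdisj hcr hc hct hr (D.ht_mem_Ioo_of_isCrossing hdisj hr hrT) hfirst

/-- **Before a crossing of the segment strictly inside, a leaf disjoint from `L` never crossed the
segment.** [folklore] -/
theorem not_isCrossing_before (he : e ∈ F.atlas) (hι : IsOpenEmbedding ι) (hdisj : Disjoint (F.leaf y) (F.leaf x))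
    {c : F.Leaf y} (hc : IsCrossing e u₀ c) (hct : ht e c ∈ Ioo D.tlo D.thi) {s : F.Leaf y} (hsc : leafLT hbi s c)
    (hs : IsCrossing e u₀ s) : ht e s ∉ Icc D.tlo D.thi := by
  intro hsT
  -- the last crossing before `c` with height in `[tlo, thi]`, after `s`
  set S : Set (F.Leaf y) := {r ∈ leafIcc hbi s c | IsCrossing e u₀ r ∧ ht e r ∈ Icc D.tlo D.thi} ∩ {r | leafLT hbi r c}
    with hSdef
  have hSf : S.Finite := (finite_crossings_leafIcc hbi he isClosed_Icc (Metric.isBounded_Icc _ _) s c).inter_of_left _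
  have hsS : s ∈ S := ⟨⟨left_mem_leafIcc (leafLT_asymm hsc), hs, hsT⟩, hsc⟩
  obtain ⟨n, hn⟩ := exists_subset_lineCharts_source (hbi := hbi) (isCompact_leafIcc (hbi := hbi) s c)
  obtain ⟨r, hrS, hrmax⟩ := Set.exists_max_image S (lineCharts hbi y n) hSf ⟨s, hsS⟩
  have hrI : r ∈ leafIcc hbi s c := hrS.1.1
  have hlast : ∀ s', leafLT hbi r s' → leafLT hbi s' c → ¬ (IsCrossing e u₀ s' ∧ ht e s' ∈ Icc D.tlo D.thi) := by
    intro s' hrs' hs'c hs'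
    have hss' : leafLT hbi s s' := by
      rcases not_leafLT_iff.1 hrI.1 with h | h
      · exact leafLT_trans h hrs'
      · exact h ▸ hrs'
    have hs'S : s' ∈ S := ⟨⟨⟨leafLT_asymm hss', leafLT_asymm hs'c⟩, hs'⟩, hs'c⟩
    have hle := hrmax s' hs'S
    have hlt := (leafLT_iff (hn hrI) (hn hs'S.1.1)).1 hrs'
    exact absurd hle (not_le.2 hlt)
  exact D.false_of_crossings he hι hdisj hrS.2 hrS.1.2.1 (D.ht_mem_Ioo_of_isCrossing hdisj hrS.1.2.1 hrS.1.2.2)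
    hc hct hlast

/-- **The forward trap**: after a crossing of the vertical segment strictly inside, a leaf disjoint
from `L` stays in the right side of the sack. [cite: CamachoLinsNeto1985, Ch. VII §2] -/
theorem mem_rightSide_of_fwd (he : e ∈ F.atlas) (hι : IsOpenEmbedding ι) (hdisj : Disjoint (F.leaf y) (F.leaf x))
    {c : F.Leaf y} (hc : IsCrossing e u₀ c) (hct : ht e c ∈ Ioo D.tlo D.thi) {q : F.Leaf y} (hq : leafLT hbi c q) :
    ι (Leaf.pt q) ∈ D.rightSide he ι := by
  have hιc := hι.continuous
  have hιi := hι.injective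
  obtain ⟨q', hqq'⟩ : ∃ q', leafLT hbi q q' := (frequently_leafLT_right (hbi := hbi) q).exists
  set O := leafIoo hbi c q' with hO
  set S := (fun s : F.Leaf y ↦ ι (Leaf.pt s)) '' O with hS
  have hSc : IsPreconnected S :=
    (isPreconnected_leafIoo c q').image _ (hιc.comp (Leaf.continuous_coe F y)).continuousOn
  have hSsub : S ⊆ (ι '' D.traceX)ᶜ := by
    rintro _ ⟨s, ⟨hs₁, -⟩, rfl⟩ hs
    obtain ⟨hcr, hsT⟩ := D.isCrossing_of_mem_traceX he hιi hdisj hs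
    exact D.not_isCrossing_after he hι hdisj hc hct hs₁ hcr hsT
  obtain ⟨q₁, hq₁O, hq₁R⟩ : ∃ q₁ ∈ O, ι (Leaf.pt q₁) ∈ D.rightSide he ι := by
    have hev := (isOpen_setOf_leafLT_left (hbi := hbi) q').mem_nhds (leafLT_trans hq hqq')
    have h := (frequently_leafLT_right (hbi := hbi) c).and_eventually
      ((D.eventually_mem_rightSide_after_of_isCrossing he hιc hιi hc hct).and hev)
    obtain ⟨q₁, hlt, himp, hq'⟩ := h.exists
    exact ⟨q₁, ⟨hlt, hq'⟩, himp hlt⟩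
  have hqO : q ∈ O := ⟨hq, hqq'⟩
  have key := hSc.subset_connectedComponentIn (mem_image_of_mem _ hq₁O) hSsub (mem_image_of_mem _ hqO)
  rw [rightSide] at hq₁R ⊢
  rwa [connectedComponentIn_eq hq₁R]

/-- **The backward trap**: before a crossing of the vertical segment strictly inside, a leaf
disjoint from `L` stays in the left side of the sack. [cite: CamachoLinsNeto1985, Ch. VII §2] -/
theorem mem_leftSide_of_bwd (he : e ∈ F.atlas) (hι : IsOpenEmbedding ι) (hdisj : Disjoint (F.leaf y) (F.leaf x))
    {c : F.Leaf y} (hc : IsCrossing e u₀ c) (hct : ht e c ∈ Ioo D.tlo D.thi) {q : F.Leaf y} (hq : leafLT hbi q c) :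
    ι (Leaf.pt q) ∈ D.leftSide he ι := by
  have hιc := hι.continuous
  have hιi := hι.injective
  obtain ⟨q', hq'q⟩ : ∃ q', leafLT hbi q' q := (frequently_leafLT_left (hbi := hbi) q).exists
  set O := leafIoo hbi q' c with hO
  set S := (fun s : F.Leaf y ↦ ι (Leaf.pt s)) '' O with hS
  have hSc : IsPreconnected S :=
    (isPreconnected_leafIoo q' c).image _ (hιc.comp (Leaf.continuous_coe F y)).continuousOn
  have hSsub : S ⊆ (ι '' D.traceX)ᶜ := by
    rintro _ ⟨s, ⟨-, hs₂⟩, rfl⟩ hs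
    obtain ⟨hcr, hsT⟩ := D.isCrossing_of_mem_traceX he hιi hdisj hs
    exact D.not_isCrossing_before he hι hdisj hc hct hs₂ hcr hsT
  obtain ⟨q₂, hq₂O, hq₂L⟩ : ∃ q₂ ∈ O, ι (Leaf.pt q₂) ∈ D.leftSide he ι := by
    have hev := (isOpen_setOf_leafLT_right (hbi := hbi) q').mem_nhds (leafLT_trans hq'q hq)
    have h := (frequently_leafLT_left (hbi := hbi) c).and_eventually
      ((D.eventually_mem_leftSide_before_of_isCrossing he hιc hιi hc hct).and hev)
    obtain ⟨q₂, hlt, himp, hq''⟩ := h.exists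
    exact ⟨q₂, ⟨hq'', hlt⟩, himp hlt⟩
  have hqO : q ∈ O := ⟨hq'q, hq⟩
  have key := hSc.subset_connectedComponentIn (mem_image_of_mem _ hq₂O) hSsub (mem_image_of_mem _ hqO)
  rw [leftSide] at hq₂L ⊢
  rwa [connectedComponentIn_eq hq₂L]

/-! ## The limit sets -/

/-- **The ω-limit set of a trapped leaf lies in the closure of the right side.** [folklore] -/
theorem omegaSet_subset_closure_rightSide (he : e ∈ F.atlas) (hι : IsOpenEmbedding ι) (hdisj : Disjoint (F.leaf y) (F.leaf x))
    {c : F.Leaf y} (hc : IsCrossing e u₀ c) (hct : ht e c ∈ Ioo D.tlo D.thi) :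
    omegaSet hbi ι y ⊆ closure (D.rightSide he ι) := by
  obtain ⟨c', hcc'⟩ : ∃ c', leafLT hbi c c' := (frequently_leafLT_right (hbi := hbi) c).exists
  intro z hz
  refine closure_mono ?_ (mem_omegaSet_iff.1 hz c')
  rintro _ ⟨q, hq, rfl⟩
  have hcq : leafLT hbi c q := by
    rcases not_leafLT_iff.1 hq with h | h
    · exact leafLT_trans hcc' h
    · exact h ▸ hcc'
  exact D.mem_rightSide_of_fwd he hι hdisj hc hct hcq

/-- **The α-limit set of a trapped leaf lies in the closure of the left side.** [folklore] -/
theorem alphaSet_subset_closure_leftSide (he : e ∈ F.atlas) (hι : IsOpenEmbedding ι) (hdisj : Disjoint (F.leaf y) (F.leaf x))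
    {c : F.Leaf y} (hc : IsCrossing e u₀ c) (hct : ht e c ∈ Ioo D.tlo D.thi) :
    alphaSet hbi ι y ⊆ closure (D.leftSide he ι) := by
  obtain ⟨c', hc'c⟩ : ∃ c', leafLT hbi c' c := (frequently_leafLT_left (hbi := hbi) c).exists
  intro z hz
  refine closure_mono ?_ (mem_alphaSet_iff.1 hz c')
  rintro _ ⟨q, hq, rfl⟩
  have hqc : leafLT hbi q c := by
    rcases not_leafLT_iff.1 hq with h | h
    · exact leafLT_trans h hc'c
    · exact h ▸ hc'c
  exact D.mem_leftSide_of_bwd he hι hdisj hc hct hqc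

end SackData

end Literature.Topology.PlanarFoliations
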